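import Summits.ResolutionOfSingularities.ResolutionOfSingularities.Theorems.WildConesCampaignW46HypersurfacesCharTwoEmbDimDefs

/-!
# [OURS · L1 W4.6, rung (ii) at p = 2, EVERY dimension n] DEFINITIONS: the colength of the 3-jet of
# the gradient ideal, `jetThreeColength`, and THE HILBERT FUNCTION OF THE MILNOR ALGEBRA AT DEGREE 2,
# `milnorHilbertTwo` — the invariant that decides the case `e = 2` left open by gen 3's trichotomy

HONEST FRAMING. Everything here is OURS: bookkeeping definitions over route WildCones' own TYPED
point-blow-up dynamics (`Theorems/WildConesClassicalRegimesDefs.lean`: a state is the coefficient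
function `c : (Fin n → ℕ) → κ` of `a = Σ c(A) u^A` in `z^p = a(u₁,…,uₙ)`; `ser` its cleaned power
series, `jac` its gradient ideal, `Isol` = finite Milnor algebra `κ⟦u⟧/(∂a)`, `mu` = its dimension) and
gen 3's `Theorems/WildConesCampaignW46HypersurfacesCharTwoEmbDimDefs.lean` (p498937: `jetTwoColength f
= dim_κ κ⟦X⟧/((∂f) + 𝔪²)`, `milnorEmbDim p n κ c = e(c)` = embedding dimension of the Milnor algebra).
Nothing here is a statement of H. Hironaka's manuscript [Hironaka2017] and nothing of it is used; no
FACT-LIST premise is used. AI bookkeeping, weaker than expert review. Cell res-hironaka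
(LADDER-RESOLUTION rung L, D-0089), slot W4.6 «restricted regimes as rungs», seat res-L1-s46-pv-4
(gen 4): «(ii) THREEFOLD HYPERSURFACES, second prover: the p = 2 hyperbolic-splitting regime of
`ClassicalRegimes` (n ≥ 3, order-2 cleaned states)». Host: route `WildCones`, crux `ClassicalRegimes`
(stmt-ResolutionOfSingularities-16884; proved). `--kind definition --supports` that item.

WHY. Gen 3 (p501990 `hypersurface_trichotomy`, p506168 `CampaignW46HypersurfacesEmbDimTrichotomy`)
decided whether the next infinitely-near double point of an isolated double point `z² = a(u₁,…,uₙ)`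
(characteristic `2`) is again ISOLATED by the embedding dimension `e(c) = dim_κ 𝔪_A/𝔪_A²` of the
Milnor algebra `A = κ⟦u⟧/(∂a)`: yes for `e ≤ 1`, no for `e ≥ 3`, and NOTHING for `e = 2` (kernel
witnesses both ways in `n = 4`, p507619). This seat's gen 4 decides the case `e = 2` by the NEXT value
of the Hilbert function of `A`,
`h₂(c) = dim_κ 𝔪_A²/𝔪_A³ = jetThreeColength a − jetTwoColength a`,
where `jetThreeColength f = dim_κ κ⟦X⟧/((∂f) + 𝔪³)` is defined here exactly like gen 3's
`jetTwoColength`. For `e = 2` one has `h₂ ∈ {1, 2, 3}`; after splitting all hyperbolic pairs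
(Greuel–Pfister, the tree's `exists_residual`) the residual germ is a plane germ `g(x, y)` of order
`≥ 3` modulo squares, and `h₂ = 3 − r` where `r` is the rank of the pair of (diagonal) quadratic forms
`(∂g/∂x)₂, (∂g/∂y)₂` — `r = 2` iff the tangent cubic of `g` has three distinct roots, `r = 0` iff it
vanishes. The theorems (files `…HypersurfacesCharTwoHilbert*.lean`, `…TangentCone*.lean`,
`…IsolTransfer*.lean` of this seat) are: `h₂ = 3` ⇒ every double successor is NON-isolated; `h₂ ≤ 2`
and the state isolated ⇒ every double successor IS isolated; `h₂ = 1` ⇒ every double successor has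
`e = 0`, `μ = 1` and is resolved by the next blow-up.

No theorem with content is proved here: two definitions.

References: G.-M. Greuel, G. Pfister, The splitting lemma in any characteristic, J. Algebra 689 (2026)
= arXiv:2507.17078 [GreuelPfister2026] (context: the residual germ); H. Hironaka, ms. 2017-03-23
[Hironaka2017], Th. 16.6 p.84, Th. 16.13 p.87 — quoted for the ROLE the campaign statements replace,
under adjudication, never as fact.
-/

noncomputable section

set_option linter.dupNamespace false -- mandated namespace of this single-conjunct summit

open scoped Classical

open MvPowerSeries IsLocalRing

open Literature.AlgebraicGeometry.Resolution

namespace Summit.ResolutionOfSingularities.ResolutionOfSingularities.Theorems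

namespace CampaignW46

/-- [OURS · L1 W4.6; NOT a statement of the manuscript] **The colength of the 3-jet of the gradient
ideal**: for `f ∈ κ⟦X₁,…,Xₙ⟧`, `jetThreeColength f = dim_κ κ⟦X⟧ / ((∂₁f,…,∂ₙf) + 𝔪³)`. When the
partials lie in `𝔪` this is `dim_κ A/𝔪_A³` for the Milnor algebra `A = κ⟦X⟧/(∂f)` — the sum of the
first three values `1 + h₁ + h₂` of the Hilbert function of `A` (`h₁ = edim A`). Companion of gen 3's
`jetTwoColength` (`= 1 + h₁`). [folklore] -/
def jetThreeColength {n : ℕ} {κ : Type} [Field κ] (f : MvPowerSeries (Fin n) κ) : ℕ :=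
  Module.finrank κ (MvPowerSeries (Fin n) κ ⧸
    (Ideal.span (Set.range fun s : Fin n => MvPowerSeries.pderiv s f) ⊔
      maximalIdeal (MvPowerSeries (Fin n) κ) ^ 3))

/-- [OURS · L1 W4.6; NOT a statement of the manuscript] **The Hilbert function of the Milnor algebra
at degree 2** of a state of route WildCones' point-blow-up dynamics (`z^p = a(u₁,…,uₙ)`, `a = ser p n κ c`
the cleaned series): `h₂(c) = dim_κ 𝔪_A²/𝔪_A³` for `A = κ⟦u⟧/(∂₁a,…,∂ₙa)`, computed as
`jetThreeColength a - jetTwoColength a`. For a double point in characteristic `2` with `e(c) = 2`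
(polar form of corank two) it takes the values `1, 2, 3` and equals `3 −` the rank of the Jacobian pair
of quadratic forms of the residual plane cubic: `h₂ = 1` iff the tangent cone of the residual plane germ
is three distinct lines, `h₂ = 3` iff the residual germ has order `≥ 4` modulo squares. [folklore] -/
def milnorHilbertTwo (p n : ℕ) (κ : Type) [Field κ] (c : (Fin n → ℕ) → κ) : ℕ :=
  jetThreeColength (WildCones.ser p n κ c) - jetTwoColength (WildCones.ser p n κ c)

end CampaignW46

end Summit.ResolutionOfSingularities.ResolutionOfSingularities.Theorems

end
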